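import Summits.Ventures.PercRepro.Night2ThreeFatCount

/-!
# PercRepro — series transitivity and the TRIANGLE count of the covering bases (night-2, gen 23)

Two fat hyperplanes `H₀ = G ∖ {p, x}`, `H₁ = G ∖ {p, y}` of a coloop-free flat `G` (two 2-cocircuits sharing the
point `p`) force a third, `G ∖ {x, y}` (`eRk_sdiff_pair_le_of_series`: series pairs are transitive — with
`X = G ∖ {p, x, y}`, a full rank of `X ∪ {p}` forces `rk X = q`, so `cl X` contains both hyperplanes and `G ∖ {p}`, and
`p` would be a coloop).  Three hyperplanes missing `{p, x}`, `{p, y}`, `{x, y}` bound the covering bases of a target by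

  `cntTriangle ρ s = C(s, ρ) − 3·C(s − 2, ρ) + 2·C(s − 3, ρ)`

(`card_coverBases_le_cntTriangle`: the exact three-set inclusion–exclusion, the pairwise and triple traces all equal
`s − |S′ ∩ {p, x, y}|`, and `Σ_i |S′ ∩ P_i| = 2 |S′ ∩ {p, x, y}|` since every point of the triangle lies in two of the
missed pairs — `card_inter_pair_add_eq`; the binomial inequality `choose_triangle_le` is the second difference of
`C(·, ρ)`).  With the chord of gen 20 the count sum at `(3, 0)`, `n = 10` is `18934/18655 = 1.015`.
-/

namespace PercRepro.Shadow

open Finset PerFlat ThmH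

/-- The triangle count `C(s, ρ) − 3·C(s − 2, ρ) + 2·C(s − 3, ρ)`. -/
noncomputable def cntTriangle (ρ s : ℕ) : ℚ :=
  (s.choose ρ : ℚ) - 3 * ((s - 2).choose ρ : ℚ) + 2 * ((s - 3).choose ρ : ℚ)

/-- `cntTriangle 6 s > 0` for `7 ≤ s ≤ 12`. -/
theorem cntTriangle_six_pos : ∀ s, 7 ≤ s → s ≤ 12 → 0 < cntTriangle 6 s := by
  intro s h1 h2
  unfold cntTriangle
  interval_cases s <;> norm_num [Nat.choose_eq_descFactorial_div_factorial, Nat.descFactorial, Nat.factorial]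

/-- **The binomial inequality behind the triangle count**: with `c_i = 3 − a_i` (`a_i` = the points of the target in
the `i`-th missed pair), `p = 3 − u` (`u` = the points of the target in the triangle) and `Σ c_i = 3 + 2p`,
`2·C(m+p) + 3·C(m+1) ≤ Σ_i C(m+c_i) + 2·C(m)` (top index `t + 1`; the second difference of `C(·, t+1)`). -/
theorem choose_triangle_le (t m c₀ c₁ c₂ p : ℕ) (h₀ : 1 ≤ c₀) (h₀' : c₀ ≤ 3) (h₁ : 1 ≤ c₁) (h₁' : c₁ ≤ 3)
    (h₂ : 1 ≤ c₂) (h₂' : c₂ ≤ 3) (hp : p ≤ 3) (hsum : c₀ + c₁ + c₂ = 3 + 2 * p) :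
    2 * (m + p).choose (t + 1) + 3 * (m + 1).choose (t + 1) ≤
      (m + c₀).choose (t + 1) + (m + c₁).choose (t + 1) + (m + c₂).choose (t + 1) + 2 * m.choose (t + 1) := by
  have a0 : (m + 1).choose (t + 1) = m.choose t + m.choose (t + 1) := Nat.choose_succ_succ m t
  have a1 : (m + 2).choose (t + 1) = (m + 1).choose t + (m + 1).choose (t + 1) := Nat.choose_succ_succ (m + 1) t
  have a2 : (m + 3).choose (t + 1) = (m + 2).choose t + (m + 2).choose (t + 1) := Nat.choose_succ_succ (m + 2) t
  have b0 : m.choose t ≤ (m + 1).choose t := Nat.choose_le_choose t (by omega)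
  have b1 : (m + 1).choose t ≤ (m + 2).choose t := Nat.choose_le_choose t (by omega)
  interval_cases c₀ <;> interval_cases c₁ <;> interval_cases c₂ <;> interval_cases p <;>
    simp only [Nat.add_zero, Nat.add_assoc, Nat.reduceAdd] at * <;> omega

variable {α : Type*} [DecidableEq α]

/-- Every point of a triangle `{p, x, y}` lies in exactly two of its three pairs:
`|S ∩ {p, x}| + |S ∩ {p, y}| + |S ∩ {x, y}| = 2 |S ∩ {p, x, y}|`. -/
theorem card_inter_pair_add_eq (S : Finset α) {p x y : α} (hpx : p ≠ x) (hpy : p ≠ y) (hxy : x ≠ y) :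
    (S ∩ {p, x}).card + (S ∩ {p, y}).card + (S ∩ {x, y}).card = 2 * (S ∩ {p, x, y}).card := by
  rw [Finset.inter_comm S {p, x}, Finset.inter_comm S {p, y}, Finset.inter_comm S {x, y},
    Finset.inter_comm S {p, x, y}]
  by_cases hp : p ∈ S <;> by_cases hx : x ∈ S <;> by_cases hy : y ∈ S <;>
    simp [Finset.insert_inter_of_mem, Finset.insert_inter_of_notMem, Finset.singleton_inter_of_mem,
      Finset.singleton_inter_of_notMem, hp, hx, hy, Finset.card_insert_of_notMem, hpx, hpy, hxy]

variable {M : Matroid α} [M.Finite]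

/-- **Series transitivity** (general form): two rank-`≤ q` sets missing `{p, x}` and `{p, y}` of a flat `G` of rank
`q + 1` force `G ∖ {x, y}` to have rank `≤ q`, provided the shared point `p` is not a coloop of `G` (with
`X = G ∖ {p, x, y}`, a full rank of `X ∪ {p}` forces `rk X = q`, so `cl X` contains both sets and `G ∖ {p}`, and `p`
would be a coloop). -/
theorem eRk_sdiff_pair_le_of_series' {q : ℕ} {G : Finset α} (hG : G ∈ flatsQ M (q + 1))
    {H₀ H₁ : Finset α} (hH₀ : M.eRk (H₀ : Set α) ≤ (q : ℕ∞)) (hH₁ : M.eRk (H₁ : Set α) ≤ (q : ℕ∞))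
    {p x y : α} (hP₀ : G \ H₀ = {p, x}) (hP₁ : G \ H₁ = {p, y}) (hpx : p ≠ x) (hpy : p ≠ y) (hxy : x ≠ y)
    (hpK : p ∉ coloops M G) :
    M.eRk ((G \ {x, y} : Finset α) : Set α) ≤ (q : ℕ∞) := by
  have hGg : G ⊆ gr M := (mem_flatsQ.1 hG).1
  have hrG : rkN M G = q + 1 := rkN_eq_of_mem_flatsQ hG
  have hpG : p ∈ G := by
    have : p ∈ G \ H₀ := by rw [hP₀]; simp
    exact (Finset.mem_sdiff.1 this).1
  have hxG : x ∈ G := by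
    have : x ∈ G \ H₀ := by rw [hP₀]; simp
    exact (Finset.mem_sdiff.1 this).1
  have hyG : y ∈ G := by
    have : y ∈ G \ H₁ := by rw [hP₁]; simp
    exact (Finset.mem_sdiff.1 this).1
  set X := G \ {p, x, y} with hX
  have hXH₀ : X ⊆ H₀ := by
    intro z hz
    rw [hX, Finset.mem_sdiff] at hz
    by_contra hzH
    have : z ∈ G \ H₀ := Finset.mem_sdiff.2 ⟨hz.1, hzH⟩
    rw [hP₀] at this
    apply hz.2
    simp only [Finset.mem_insert, Finset.mem_singleton] at this ⊢
    tauto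
  have hXH₁ : X ⊆ H₁ := by
    intro z hz
    rw [hX, Finset.mem_sdiff] at hz
    by_contra hzH
    have : z ∈ G \ H₁ := Finset.mem_sdiff.2 ⟨hz.1, hzH⟩
    rw [hP₁] at this
    apply hz.2
    simp only [Finset.mem_insert, Finset.mem_singleton] at this ⊢
    tauto
  have hXG : X ⊆ G := Finset.sdiff_subset
  have hH₀G : H₀ ∩ G ⊆ G := Finset.inter_subset_right
  -- `rk X ≤ q`
  have hrX : rkN M X ≤ q := by
    have h1 : M.eRk (X : Set α) ≤ M.eRk (H₀ : Set α) := M.eRk_mono (Finset.coe_subset.2 hXH₀)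
    have h2 := h1.trans hH₀
    rw [eRk_eq_rkN] at h2
    exact_mod_cast h2
  by_contra hcon
  push Not at hcon
  -- `G ∖ {x, y} = insert p X`, so `rk X ≥ q`
  have heq : G \ {x, y} = insert p X := by
    ext z
    simp only [hX, Finset.mem_sdiff, Finset.mem_insert, Finset.mem_singleton]
    constructor
    · rintro ⟨hzG, hz⟩
      by_cases hzp : z = p
      · exact Or.inl hzp
      · exact Or.inr ⟨hzG, fun h => by rcases h with h | h | h <;> [exact hzp h; exact hz (Or.inl h); exact hz (Or.inr h)]⟩
    · rintro (rfl | ⟨hzG, hz⟩)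
      · exact ⟨hpG, fun h => by rcases h with h | h <;> [exact hpx h; exact hpy h]⟩
      · exact ⟨hzG, fun h => hz (by rcases h with h | h <;> [exact Or.inr (Or.inl h); exact Or.inr (Or.inr h)])⟩
  have hins : M.eRk ((insert p X : Finset α) : Set α) ≤ M.eRk (X : Set α) + 1 := by
    rw [Finset.coe_insert]
    exact M.eRk_insert_le_add_one p (X : Set α)
  rw [heq] at hcon
  rw [eRk_eq_rkN, eRk_eq_rkN] at hins
  have hins' : rkN M (insert p X) ≤ rkN M X + 1 := by exact_mod_cast hins
  have hcon' : q < rkN M (insert p X) := by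
    rw [eRk_eq_rkN] at hcon
    exact_mod_cast hcon
  have hrX' : rkN M X = q := by omega
  -- `cl X ⊇ H₀ ∋ y` and `cl X ⊇ H₁ ∋ x`
  have hyH₀ : y ∈ H₀ := by
    by_contra h
    have : y ∈ G \ H₀ := Finset.mem_sdiff.2 ⟨hyG, h⟩
    rw [hP₀] at this
    simp only [Finset.mem_insert, Finset.mem_singleton] at this
    rcases this with h' | h' <;> [exact hpy h'.symm; exact hxy h'.symm]
  have hxH₁ : x ∈ H₁ := by
    by_contra h
    have : x ∈ G \ H₁ := Finset.mem_sdiff.2 ⟨hxG, h⟩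
    rw [hP₁] at this
    simp only [Finset.mem_insert, Finset.mem_singleton] at this
    rcases this with h' | h' <;> [exact hpx h'.symm; exact hxy h']
  have hH₀' : rkN M (H₀ ∩ G) = q := by
    have h1 : rkN M X ≤ rkN M (H₀ ∩ G) := rkN_mono (Finset.subset_inter hXH₀ hXG)
    have h2 : rkN M (H₀ ∩ G) ≤ q := by
      have := M.eRk_mono (Finset.coe_subset.2 (Finset.inter_subset_left : H₀ ∩ G ⊆ H₀))
      have h3 := this.trans hH₀
      rw [eRk_eq_rkN] at h3
      exact_mod_cast h3
    omega
  have hH₁' : rkN M (H₁ ∩ G) = q := by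
    have h1 : rkN M X ≤ rkN M (H₁ ∩ G) := rkN_mono (Finset.subset_inter hXH₁ hXG)
    have h2 : rkN M (H₁ ∩ G) ≤ q := by
      have := M.eRk_mono (Finset.coe_subset.2 (Finset.inter_subset_left : H₁ ∩ G ⊆ H₁))
      have h3 := this.trans hH₁
      rw [eRk_eq_rkN] at h3
      exact_mod_cast h3
    omega
  have hycl : y ∈ clF M X := by
    have hsub := subset_closure_of_rkN_eq (S := H₀ ∩ G) (K := X) (Finset.inter_subset_right.trans hGg)
      (Finset.subset_inter hXH₀ hXG) (by rw [hrX', hH₀'])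
    have : (y : α) ∈ M.closure (X : Set α) := hsub (by exact_mod_cast Finset.mem_inter.2 ⟨hyH₀, hyG⟩)
    rw [← coe_clF] at this
    exact_mod_cast this
  have hxcl : x ∈ clF M X := by
    have hsub := subset_closure_of_rkN_eq (S := H₁ ∩ G) (K := X) (Finset.inter_subset_right.trans hGg)
      (Finset.subset_inter hXH₁ hXG) (by rw [hrX', hH₁'])
    have : (x : α) ∈ M.closure (X : Set α) := hsub (by exact_mod_cast Finset.mem_inter.2 ⟨hxH₁, hxG⟩)
    rw [← coe_clF] at this
    exact_mod_cast this
  -- so `G ∖ {p} ⊆ cl X` has rank `≤ q`: `p` is a coloop of `G`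
  have hGp : G.erase p ⊆ clF M X := by
    intro z hz
    rw [Finset.mem_erase] at hz
    by_cases hzx : z = x
    · rw [hzx]; exact hxcl
    by_cases hzy : z = y
    · rw [hzy]; exact hycl
    have hzX : z ∈ X := by
      rw [hX, Finset.mem_sdiff]
      refine ⟨hz.2, ?_⟩
      simp only [Finset.mem_insert, Finset.mem_singleton]
      tauto
    exact subset_clF_of_subset_gr (hXG.trans hGg) hzX
  have hrGp : rkN M (G.erase p) ≤ q := by
    have := rkN_le_of_subset_clF' hGp
    omega
  have hpcol : p ∈ coloops M G := by
    rw [mem_coloops]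
    refine ⟨hpG, ?_⟩
    intro hpcl
    have hGsub : G ⊆ clF M (G.erase p) := by
      intro z hz
      by_cases hzp : z = p
      · rw [hzp]; exact hpcl
      · exact subset_clF_of_subset_gr ((Finset.erase_subset p G).trans hGg) (Finset.mem_erase.2 ⟨hzp, hz⟩)
    have := rkN_le_of_subset_clF' hGsub
    omega
  exact hpK hpcol

/-- **Series transitivity on a coloop-free flat**: two rank-`≤ q` sets missing `{p, x}` and `{p, y}` force
`G ∖ {x, y}` to have rank `≤ q`. -/
theorem eRk_sdiff_pair_le_of_series {q : ℕ} {G : Finset α} (hG : G ∈ flatsQ M (q + 1)) (hk0 : kColoops M G = 0)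
    {H₀ H₁ : Finset α} (hH₀ : M.eRk (H₀ : Set α) ≤ (q : ℕ∞)) (hH₁ : M.eRk (H₁ : Set α) ≤ (q : ℕ∞))
    {p x y : α} (hP₀ : G \ H₀ = {p, x}) (hP₁ : G \ H₁ = {p, y}) (hpx : p ≠ x) (hpy : p ≠ y) (hxy : x ≠ y) :
    M.eRk ((G \ {x, y} : Finset α) : Set α) ≤ (q : ℕ∞) := by
  refine eRk_sdiff_pair_le_of_series' hG hH₀ hH₁ hP₀ hP₁ hpx hpy hxy ?_
  intro hpcol
  have : 0 < kColoops M G := by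
    rw [kColoops_eq_card_coloops]
    exact Finset.card_pos.2 ⟨p, hpcol⟩
  omega

open scoped Classical in
/-- **The triangle count**: three rank-`≤ q` sets `H₀, H₁, H₂ ⊇ K` of `G` missing `{p, x}`, `{p, y}`, `{x, y}` bound
the covering bases of every target `S ⊆ G` by `cntTriangle ρ |S ∖ K|` (`ρ ≥ 4`). -/
theorem card_coverBases_le_cntTriangle {q ρ : ℕ} {G : Finset α} (hk : kColoops M G + ρ = q + 1) (hρ : 4 ≤ ρ)
    {H₀ H₁ H₂ : Finset α} (hK₀ : coloops M G ⊆ H₀) (hH₀ : M.eRk (H₀ : Set α) ≤ (q : ℕ∞))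
    (hK₁ : coloops M G ⊆ H₁) (hH₁ : M.eRk (H₁ : Set α) ≤ (q : ℕ∞))
    (hK₂ : coloops M G ⊆ H₂) (hH₂ : M.eRk (H₂ : Set α) ≤ (q : ℕ∞))
    {p x y : α} (hP₀ : G \ H₀ = {p, x}) (hP₁ : G \ H₁ = {p, y}) (hP₂ : G \ H₂ = {x, y})
    (hpx : p ≠ x) (hpy : p ≠ y) (hxy : x ≠ y)
    {S : Finset α} (hSG : S ⊆ G) :
    ((coverBases M G S ρ).card : ℚ) ≤ cntTriangle ρ (S \ coloops M G).card := by
  set S' := S \ coloops M G with hS'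
  have hS'G : S' ⊆ G := Finset.sdiff_subset.trans hSG
  have h0 : (coverBases M G S ρ).card ≤ S'.card.choose ρ := card_coverBases_le G S ρ
  by_cases hsmall : S'.card ≤ ρ + 1
  · unfold cntTriangle
    rw [Nat.choose_eq_zero_of_lt (by omega : S'.card - 2 < ρ), Nat.choose_eq_zero_of_lt (by omega : S'.card - 3 < ρ)]
    have h5 := (Nat.cast_le (α := ℚ)).2 h0
    push_cast at h5 ⊢
    linarith
  push Not at hsmall
  obtain ⟨t, rfl⟩ : ∃ t, ρ = t + 1 := ⟨ρ - 1, by omega⟩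
  obtain ⟨m, hm⟩ : ∃ m, S'.card = m + 3 := ⟨S'.card - 3, by omega⟩
  have h1 := card_coverBases_le_of_three_subset_rank hk hK₀ hH₀ hK₁ hH₁ hK₂ hH₂ S
  rw [← hS'] at h1
  -- the missed parts of the target are its traces on the pairs
  have hsd : ∀ {H : Finset α}, S' \ H = S' ∩ (G \ H) := by
    intro H
    ext z
    simp only [Finset.mem_sdiff, Finset.mem_inter]
    exact ⟨fun h => ⟨h.1, hS'G h.1, h.2⟩, fun h => ⟨h.1, h.2.2⟩⟩
  have ha₀ : (S' \ H₀).card = (S' ∩ {p, x}).card := by rw [hsd, hP₀]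
  have ha₁ : (S' \ H₁).card = (S' ∩ {p, y}).card := by rw [hsd, hP₁]
  have ha₂ : (S' \ H₂).card = (S' ∩ {x, y}).card := by rw [hsd, hP₂]
  have hpair := card_inter_pair_add_eq S' hpx hpy hxy
  have hb₀ := Finset.card_sdiff_add_card_inter S' H₀
  have hb₁ := Finset.card_sdiff_add_card_inter S' H₁
  have hb₂ := Finset.card_sdiff_add_card_inter S' H₂
  have ha₀2 : (S' ∩ {p, x}).card ≤ 2 := (Finset.card_le_card Finset.inter_subset_right).trans Finset.card_le_two
  have ha₁2 : (S' ∩ {p, y}).card ≤ 2 := (Finset.card_le_card Finset.inter_subset_right).trans Finset.card_le_two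
  have ha₂2 : (S' ∩ {x, y}).card ≤ 2 := (Finset.card_le_card Finset.inter_subset_right).trans Finset.card_le_two
  have hu3 : (S' ∩ {p, x, y}).card ≤ 3 :=
    (Finset.card_le_card Finset.inter_subset_right).trans (Finset.card_le_three)
  -- the points outside the hyperplanes
  have hpH₀ : p ∉ H₀ := by
    have : p ∈ G \ H₀ := by rw [hP₀]; simp
    exact (Finset.mem_sdiff.1 this).2
  have hxH₀ : x ∉ H₀ := by
    have : x ∈ G \ H₀ := by rw [hP₀]; simp
    exact (Finset.mem_sdiff.1 this).2
  have hpH₁ : p ∉ H₁ := by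
    have : p ∈ G \ H₁ := by rw [hP₁]; simp
    exact (Finset.mem_sdiff.1 this).2
  have hyH₁ : y ∉ H₁ := by
    have : y ∈ G \ H₁ := by rw [hP₁]; simp
    exact (Finset.mem_sdiff.1 this).2
  have hxH₂ : x ∉ H₂ := by
    have : x ∈ G \ H₂ := by rw [hP₂]; simp
    exact (Finset.mem_sdiff.1 this).2
  have hyH₂ : y ∉ H₂ := by
    have : y ∈ G \ H₂ := by rw [hP₂]; simp
    exact (Finset.mem_sdiff.1 this).2
  -- the pairwise traces miss the whole triangle: `x_ij + u ≤ s`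
  have hpairwise : ∀ {Hi Hj : Finset α}, (∀ z ∈ ({p, x, y} : Finset α), z ∉ Hi ∩ Hj) →
      (S' ∩ Hi ∩ Hj).card + (S' ∩ {p, x, y}).card ≤ S'.card := by
    intro Hi Hj hz
    have hdisj : Disjoint (S' ∩ Hi ∩ Hj) (S' ∩ {p, x, y}) := by
      rw [Finset.disjoint_left]
      intro z hz1 hz2
      rw [Finset.mem_inter] at hz2
      exact hz z hz2.2 (Finset.mem_inter.2 ⟨(Finset.mem_inter.1 (Finset.mem_inter.1 hz1).1).2, (Finset.mem_inter.1 hz1).2⟩)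
    rw [← Finset.card_union_of_disjoint hdisj]
    apply Finset.card_le_card
    apply Finset.union_subset
    · exact Finset.inter_subset_left.trans Finset.inter_subset_left
    · exact Finset.inter_subset_left
  have hx₀₁ := hpairwise (Hi := H₀) (Hj := H₁) (by
    intro z hz
    simp only [Finset.mem_insert, Finset.mem_singleton] at hz
    rw [Finset.mem_inter]
    rcases hz with rfl | rfl | rfl
    · exact fun h => hpH₀ h.1
    · exact fun h => hxH₀ h.1
    · exact fun h => hyH₁ h.2)
  have hx₀₂ := hpairwise (Hi := H₀) (Hj := H₂) (by
    intro z hz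
    simp only [Finset.mem_insert, Finset.mem_singleton] at hz
    rw [Finset.mem_inter]
    rcases hz with rfl | rfl | rfl
    · exact fun h => hpH₀ h.1
    · exact fun h => hxH₀ h.1
    · exact fun h => hyH₂ h.2)
  have hx₁₂ := hpairwise (Hi := H₁) (Hj := H₂) (by
    intro z hz
    simp only [Finset.mem_insert, Finset.mem_singleton] at hz
    rw [Finset.mem_inter]
    rcases hz with rfl | rfl | rfl
    · exact fun h => hpH₁ h.1
    · exact fun h => hxH₂ h.2
    · exact fun h => hyH₁ h.1)
  -- the triple trace together with the triangle covers the target: `y + u ≥ s`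
  have hy : S'.card ≤ (S' ∩ H₀ ∩ H₁ ∩ H₂).card + (S' ∩ {p, x, y}).card := by
    have hsub : S' ⊆ (S' ∩ H₀ ∩ H₁ ∩ H₂) ∪ (S' ∩ {p, x, y}) := by
      intro z hz
      rw [Finset.mem_union]
      by_cases hzU : z ∈ ({p, x, y} : Finset α)
      · exact Or.inr (Finset.mem_inter.2 ⟨hz, hzU⟩)
      · left
        have hzG : z ∈ G := hS'G hz
        have hz0 : z ∈ H₀ := by
          by_contra h
          have : z ∈ G \ H₀ := Finset.mem_sdiff.2 ⟨hzG, h⟩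
          rw [hP₀] at this
          apply hzU
          simp only [Finset.mem_insert, Finset.mem_singleton] at this ⊢
          tauto
        have hz1 : z ∈ H₁ := by
          by_contra h
          have : z ∈ G \ H₁ := Finset.mem_sdiff.2 ⟨hzG, h⟩
          rw [hP₁] at this
          apply hzU
          simp only [Finset.mem_insert, Finset.mem_singleton] at this ⊢
          tauto
        have hz2 : z ∈ H₂ := by
          by_contra h
          have : z ∈ G \ H₂ := Finset.mem_sdiff.2 ⟨hzG, h⟩
          rw [hP₂] at this
          apply hzU
          simp only [Finset.mem_insert, Finset.mem_singleton] at this ⊢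
          tauto
        exact Finset.mem_inter.2 ⟨Finset.mem_inter.2 ⟨Finset.mem_inter.2 ⟨hz, hz0⟩, hz1⟩, hz2⟩
    exact (Finset.card_le_card hsub).trans (Finset.card_union_le _ _)
  -- the variables of the binomial inequality
  obtain ⟨c₀, hc₀⟩ : ∃ c₀, (S' ∩ {p, x}).card + c₀ = 3 := ⟨3 - (S' ∩ {p, x}).card, by omega⟩
  obtain ⟨c₁, hc₁⟩ : ∃ c₁, (S' ∩ {p, y}).card + c₁ = 3 := ⟨3 - (S' ∩ {p, y}).card, by omega⟩
  obtain ⟨c₂, hc₂⟩ : ∃ c₂, (S' ∩ {x, y}).card + c₂ = 3 := ⟨3 - (S' ∩ {x, y}).card, by omega⟩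
  obtain ⟨pp, hpp⟩ : ∃ pp, (S' ∩ {p, x, y}).card + pp = 3 := ⟨3 - (S' ∩ {p, x, y}).card, by omega⟩
  have hcb₀ : (S' ∩ H₀).card = m + c₀ := by omega
  have hcb₁ : (S' ∩ H₁).card = m + c₁ := by omega
  have hcb₂ : (S' ∩ H₂).card = m + c₂ := by omega
  have u₀₁ : (S' ∩ H₀ ∩ H₁).card.choose (t + 1) ≤ (m + pp).choose (t + 1) := Nat.choose_le_choose _ (by omega)
  have u₀₂ : (S' ∩ H₀ ∩ H₂).card.choose (t + 1) ≤ (m + pp).choose (t + 1) := Nat.choose_le_choose _ (by omega)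
  have u₁₂ : (S' ∩ H₁ ∩ H₂).card.choose (t + 1) ≤ (m + pp).choose (t + 1) := Nat.choose_le_choose _ (by omega)
  have ly : (m + pp).choose (t + 1) ≤ (S' ∩ H₀ ∩ H₁ ∩ H₂).card.choose (t + 1) := Nat.choose_le_choose _ (by omega)
  have h3 := choose_triangle_le t m c₀ c₁ c₂ pp (by omega) (by omega) (by omega) (by omega) (by omega) (by omega)
    (by omega) (by omega)
  have e₀ : (S' ∩ H₀).card.choose (t + 1) = (m + c₀).choose (t + 1) := by rw [hcb₀]
  have e₁ : (S' ∩ H₁).card.choose (t + 1) = (m + c₁).choose (t + 1) := by rw [hcb₁]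
  have e₂ : (S' ∩ H₂).card.choose (t + 1) = (m + c₂).choose (t + 1) := by rw [hcb₂]
  have es : S'.card.choose (t + 1) = (m + 3).choose (t + 1) := by rw [hm]
  have h4 : (coverBases M G S (t + 1)).card + 3 * (m + 1).choose (t + 1) ≤
      (m + 3).choose (t + 1) + 2 * m.choose (t + 1) := by omega
  unfold cntTriangle
  rw [hm, show m + 3 - 2 = m + 1 from rfl, show m + 3 - 3 = m from rfl]
  have h5 := (Nat.cast_le (α := ℚ)).2 h4
  push_cast at h5
  linarith only [h5]

end PercRepro.Shadow
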